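import Literature.MathematicalPhysics.QuantumFieldTheory.Balaban1983to89.B9Eq325RLipschitzSqrtTowerDiagonal
import Literature.MathematicalPhysics.QuantumFieldTheory.Balaban1983to89.B9Eq319QprimeTowerLipschitzL2TwoBackgroundsChain

/-!
# `Balaban1983to89.B9Eq325RLipschitzSqrtTowerTwoBackgroundsDiagonal` — T. Bałaban, *Propagators for lattice gauge theories in a background field*,
# Commun. Math. Phys. **99** (1985) 389–434 [Balaban1985BackgroundPropagators] p. 403 «R(U), P(U) = I − R(U) extend analytically to the domain (3.37)
# and satisfy the same bounds» with (3.24)–(3.25) p. 394, (3.16) p. 393, (3.35) p. 396, (3.63)–(3.68) pp. 402–403, Thm 3.11 p. 416: **THE `k`-LEVEL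
# `R`-LETTER BETWEEN TWO SMALL BACKGROUNDS ON PRINT's DIAGONAL WITH EVERY LETTER CLOSED** — at `ηL^{n+1} = 1`, `c₀(L^{n+1})^d = c₁`, for `U`, `V` BOTH in
# the fine-bond window (`U(b), V(b) ∈ U1`, `‖U(b) − 1‖, ‖V(b) − 1‖ ≤ αη`, `hRS_U`, `hRS_V`) and MUTUALLY CLOSE (`‖U(b) − V(b)‖ ≤ δη`):
# `‖R_{n+1}(U)f − R_{n+1}(V)f‖ ≤ (δ_A⁽²⁾∕(s_V − δ_A⁽²⁾) + δ_A⁽²⁾∕s_V)·‖f‖` with `s_V = s♯ − δ_A⁽¹⁾` THE GRAM FLOOR TRANSPORTED OFF THE FLAT REFERENCE,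
# `δ_A⁽²⁾ = θ_G⁽²⁾(1+θ₁) + γ⁻¹θ₂`, `θ_G⁽²⁾ = 2δ_D⁽²⁾γ⁻¹(√γ)⁻¹ + 2|a′|θ₂(1+θ₁)γ⁻²`, `δ_D⁽²⁾ ≥ √d·2M_φM_φ′·δ` — EVERY constant a function of
# `(d, a′, M_φM_φ′, α, δ, θ₁, θ₂)`, the two `Q̃′`-letters `θ₁` (each background against the flat one) and `θ₂` (between the two) DISCHARGED by the tower
# products of ne9-leaf-02's `B9Eq319QprimeTowerLipschitzL2` and this lineage's `B9Eq319QprimeTowerLipschitzL2TwoBackgroundsChain`: NO `η`, NO volume `m`,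
# the number of levels ONLY through the displayed profile products — the first storey of the two-background twin of the NE9 owner's diagonal ladder

statement-level skeleton of published theorems with citation tags; proofs where landed; nothing here is a claim about the Yang–Mills mass gap

PDF held: `paper:balaban1985-cmp99-background-propagators` (journal page = PDF page + 388), pp. 393–396, 402–403, 416 — through the verbatim quotations
of the supplier files (`B9Eq325RLipschitzSqrt(Tower)(Diagonal)`, `B9Eq364GreenLipschitzFormTower`).

CITATION HEADER (lean-in-tree rule 2026-08-18).  Audit cell `pub-balaban`, sub-cell `t4`, NE9 crux team (2): LEAF PROVER 04
(`b2b-balaban-t4-ne9-formalise-leaf-04` gen 77), INTENT-2 (g75 HANDOFF «OPEN ∕ NOT CLAIMED: the two-background k-level `R`-letter with letters discharged —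
needs a two-background tower `θ_Q` + `κ₀` off the flat reference»).  The g85∕g86 diagonal ladder compares ONE small background with the FLAT one; NE9's two
coupling histories give TWO small backgrounds; the tree's two-background `R`-letter `B9Eq368RLipschitzTowerTwoBackgrounds.exists_RofUk_sub_RofUk_linear` is
`∃ C_R ε_R` AT A FIXED LATTICE (`C_S = (L^d)^{n+1}√(c₀·#T_m)`, `(n+1)·2^{d(L−1)(n+2)}`).  THIS FILE is its volume-free, level-free replacement on print's
diagonal: `B9Eq325RLipschitzSqrtTower.norm_RofUk_sub_RofUk_le_sqrt` (two backgrounds, five displayed letters) with (i) the Gram floor at the NON-flat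
reference `V` from ne9-leaf-01's sharp flat floor by perturbation (`‖G′(V)Q̃′(V)†ψ‖ ≥ ‖G′(1)Q̃′(1)†ψ‖ − δ_A⁽¹⁾‖ψ‖`), (ii) `θ_G(U,V)` by this lineage's
`B9Eq364GreenLipschitzFormTower.norm_GpOfUk_sub_GpOfUk_le` (already two-background) at the common coercivity of `coercive_laplacePrimeAk_of_letters`, (iii)
`δ_D(U,V) = √d·2M_φM_φ′·δ` η-FREE (`norm_covDerivL2K_sub_le₂` at `c = η⁻¹`, transporters `2M_φM_φ′δη`-close by `norm_adTransportW_sub_adTransportW_le`),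
(iv) `θ_Q(U,V)` = INTENT-1's `norm_QtildeTower_sub_QtildeTower_le`, (v) `M_Q`, `g`, `γ` as in the diagonal file.

THE PRINT (verbatim, as quoted by the suppliers).  p. 403 l. 27–28: *«These results imply that the operators R(U), P(U) = I − R(U) extend analytically
to the domain (3.37) and satisfy the same bounds»*; (3.64) p. 402: *«G′(U′U) = G′(U)(I − V′(A)G′(U))⁻¹»*; Thm 3.11 p. 416: *«… uniformly in k»*.

WHAT IS PROVED (sorry-free; 0 `def`; [folklore] composition of LANDED letters BY NAME + Hilbert-space geometry + real arithmetic; nothing of [B9] asserted).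
* §1 (the two new letters) **`norm_covDerivL2K_sub_le_diagonal₂`** (`‖D_Uλ − D_Vλ‖ ≤ √d·2M_φM_φ′·δ·‖λ‖` for `‖U(b) − V(b)‖ ≤ δη` — η-FREE: the `‖η⁻¹‖` of
  the derivative eats the `η` of the scaled closeness); **`qggqk_coercive_of_near_flat`** — THE GRAM FLOOR OFF THE FLAT REFERENCE: from a flat floor
  `s²‖ψ‖² ≤ re⟨ψ, K′_k(1)ψ⟩` and the four letters between `V` and `1` (`θ_G⁽¹⁾, M_V, θ_Q⁽¹⁾, g₁`) with `δ⁽¹⁾ := θ_G⁽¹⁾M_V + g₁θ_Q⁽¹⁾ ≤ s`: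
  `(s − δ⁽¹⁾)²‖ψ‖² ≤ re⟨ψ, K′_k(V)ψ⟩`, `K′_k(V) = Q̃′_k(V)G′_k(V)²Q̃′_k(V)†` (`re⟨ψ, K′ψ⟩ = ‖G′Q̃′†ψ‖²` by `B9Eq325ProjFormula.inner_qggq_eq`; adjoint letters by
  ne9-leaf-01's `norm_adjoint_apply_le`).
* §2 **`norm_RofUk_sub_RofUk_le_diagonal_of_thetaQ`** — with TWO displayed `Q̃′`-letters `θ₁` (`‖Q̃′_k(U) − Q̃′_k(1)‖, ‖Q̃′_k(V) − Q̃′_k(1)‖ ≤ θ₁`) and `θ₂`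
  (`‖Q̃′_k(U) − Q̃′_k(V)‖ ≤ θ₂`), the two derivative letters as UPPER BOUNDS `δ_D⁽¹⁾ ≥ √d·2M_φM_φ′α`, `δ_D⁽²⁾ ≥ √d·2M_φM_φ′δ`, and the CLOSED letters
  `γ = 1∕(2+2∕a′) − (δ_D⁽¹⁾ + (δ_D⁽¹⁾)² + a′θ₁(2+θ₁))`,
  `θ_G⁽¹⁾ = 2δ_D⁽¹⁾γ⁻¹(√γ)⁻¹ + |a′|θ₁((1+θ₁)+1)γ⁻²`, `δ_A⁽¹⁾ = θ_G⁽¹⁾(1+θ₁) + (2+2∕a′)θ₁`, `θ_G⁽²⁾ = 2δ_D⁽²⁾γ⁻¹(√γ)⁻¹ + |a′|θ₂((1+θ₁)+(1+θ₁))γ⁻²`,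
  `δ_A⁽²⁾ = θ_G⁽²⁾(1+θ₁) + γ⁻¹θ₂` (definitional equalities), in the windows `0 < γ`, `δ_D⁽¹⁾ ≤ 1∕(2+2∕a′)`, `δ_A⁽¹⁾ ≤ s♯`, `δ_A⁽²⁾ < s♯ − δ_A⁽¹⁾`
  (`s♯ = √((12d(6∕5)^{d−1} + a′)^{−2})`): **`‖R_k(U)f − R_k(V)f‖ ≤ (δ_A⁽²⁾∕((s♯ − δ_A⁽¹⁾) − δ_A⁽²⁾) + δ_A⁽²⁾∕(s♯ − δ_A⁽¹⁾))·‖f‖`**.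
* §3 **`norm_RofUk_sub_RofUk_le_diagonal`** — `θ₁`, `θ₂` DISCHARGED by the tower products for level averages `Ū^j(b), V̄^j(b) ∈ U1`, `ε_j`-small,
  `δ_j`-close (DISPLAYED): `θ₁ := Π_{j≤n}(1+2M_φM_φ′ε_j)^{d(L−1)} − 1` (leaf-02's `norm_QtildeTower_sub_flat_le`), `θ₂ := (θ₁+1)·(T − 1)` (INTENT-1's
  `norm_QtildeTower_sub_QtildeTower_le`, `T = Π_{j≤n}(1 + d(L−1)·2M_φM_φ′δ_j·(1+2M_φM_φ′ε_j)^{d(L−1)})`) with `√(c₁∕(c₀L^{(n+1)d})) = 1`.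
MODEL ∕ DECLARED READINGS.  (M1) as `B9Eq324DeltaPrimeATower` ∕ `B9Eq325RLipschitzSqrtTower`.  (M2) «diagonal» = (3.16): `ηL^{n+1} = 1`, `c₁ = c₀L^{(n+1)d}`;
the fine-bond windows `αη`, the closeness `δη`, the level-average windows `ε_j` and closeness `δ_j` are DISPLAYED (print's (3.35) ∕ [I] (1.11)–(1.14) running
axioms; neither the gauge question — Lemma 3.1 ∕ (3.37) — nor the Lipschitz continuity of `U ↦ Ū` is touched); `hRS_U`, `hRS_V` displayed.  (M3) the bound is
the `κ^{−1∕2}`-road SHAPE; its `δ`-linear reading under geometric profiles (INTENT-1's `…_linear`) and the packaging `∃ δ₀ C_R⁽²⁾` at a fixed window `α₀`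
are NOT in this file (next storey, as `B9Eq325RLipschitzSqrtTowerLinear` ∕ leaf-03's `…Packaged` were for the diagonal letter).
HONEST SCOPE.  [folklore] assembly; ONE route sub-step (S3 at `k` levels, two backgrounds) closed at the point MODULO the displayed small-field windows;
«NE9 ⇐ the named binders»; NE9 NOT PRINTED ∕ NOT PROVED; NOT summit progress (cell pub-balaban: row NE9 WALLED ON A MODEL; spine PROVED 0∕9; rung (B)+1
on a finite T⁴ — NOT infinite volume, NOT mass gap, NOT BetaPertH, NOT Clay; HONEST DEPENDENCY: continuum YM on T⁴ ⇐ BetaPertH ∧ nine spine estimates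
(0/9 proved); BetaPertH ⇐ (D1) ∧ (D4) ∧ CAP+tail; G-an2-4 gates asym, D1 and NE2/3/4).  NEW file; nothing modified.  Net new unproved facts: 0.
-/

noncomputable section

open scoped InnerProductSpace ComplexConjugate BigOperators

namespace Literature.MathematicalPhysics.QuantumFieldTheory.Balaban1983to89.B9Eq325RLipschitzSqrtTowerTwoBackgroundsDiagonal

open B4Sect5Torus (TSite)
open B9SectCLatticeCarrier (Bond)
open B9Eq311L2Pairing (WL2)
open B7Prop1Explicit (U1)
open B11Eq103H1Complex (SiteL2K greenK covDerivL2K)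
open B9Eq310HessianOperator (adTransportW)
open B9Eq315QTower (towerP UlevOf)
open B9Eq326OperatorTower (QprimeTowerW RofUk)
open B5Eq172HodgePositivity (hRS_one)
open B9Eq324DeltaPrimeATower (laplacePrimeAk GpOfUk laplacePrimeAk_one_pos laplacePrimeAk_isSymmetric)
open B9Eq325ProjFormula (inner_qggq_eq)
open B9Eq325RLipschitzSqrt (norm_adjoint_apply_le)
open B9Eq325RLipschitzSqrtTower (norm_RofUk_sub_RofUk_le_sqrt)
open B9Eq325RLipschitzSqrtTowerDiagonal (eta_pos_of_diagonal norm_covDerivL2K_sub_flat_le_diagonal norm_QtildeTower_one_le_diagonal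
  coercive_laplacePrimeAk_one_diagonal norm_GpOfUk_one_le_diagonal qggqk_coercive_sharp_one_diagonal)
open B9Eq319QprimeTowerLipschitzL2 (norm_QtildeTower_sub_flat_le)
open B9Eq319QprimeTowerLipschitzL2TwoBackgroundsChain (norm_QtildeTower_sub_QtildeTower_le)
open B9Eq373DerivativeRemainderTwoBackgrounds (norm_covDerivL2K_sub_le₂)
open B9Eq368RLipschitzTwoBackgrounds (norm_adTransportW_sub_adTransportW_le)
open B9Eq3126GreenLetters (norm_greenK_le)
open B9Eq364GreenLipschitzFormTower (coercive_laplacePrimeAk_of_letters norm_GpOfUk_sub_GpOfUk_le)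

variable {d : ℕ} (L : ℕ) [NeZero L] (m : Fin d → ℕ) [∀ i, NeZero (m i)] (n : ℕ)
  {𝔸 : Type*} [NormedRing 𝔸] [NormedAlgebra ℂ 𝔸] [CompleteSpace 𝔸] [NormOneClass 𝔸]
  {W : Type*} [NormedAddCommGroup W] [InnerProductSpace ℂ W] [FiniteDimensional ℂ W] (φ : W ≃ₗ[ℂ] 𝔸) {Mφ Mφ' : ℝ} (hMφ : 0 ≤ Mφ) (hMφ' : 0 ≤ Mφ')
  (hφ : ∀ w, ‖φ w‖ ≤ Mφ * ‖w‖) (hφ' : ∀ X, ‖φ.symm X‖ ≤ Mφ' * ‖X‖)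
  (c₀ : ℝ) [Fact (0 < c₀)] (η : ℝ) (c₁ : ℝ) [Fact (0 < c₁)] {a' : ℝ} (ha' : 0 < a')
  (hηL : η * (L : ℝ) ^ (n + 1) = 1) (hw : c₀ * ((L : ℝ) ^ (n + 1)) ^ d = c₁)
  (U V : Bond d (towerP L m (n + 1)) → 𝔸ˣ)
  (hRSU : ∀ (b : Bond d (towerP L m (n + 1))) (v u : W), ⟪adTransportW φ U b v, u⟫_ℂ = ⟪v, adTransportW φ (fun b => (U b)⁻¹) b u⟫_ℂ)
  (hRSV : ∀ (b : Bond d (towerP L m (n + 1))) (v u : W), ⟪adTransportW φ V b v, u⟫_ℂ = ⟪v, adTransportW φ (fun b => (V b)⁻¹) b u⟫_ℂ)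
  {α δ : ℝ} (hα : 0 ≤ α) (hδ : 0 ≤ δ) (hUb : ∀ b, U b ∈ U1 𝔸) (hVb : ∀ b, V b ∈ U1 𝔸) (hUε : ∀ b, ‖(U b : 𝔸) - 1‖ ≤ α * η)
  (hVε : ∀ b, ‖(V b : 𝔸) - 1‖ ≤ α * η) (hUV : ∀ b, ‖(U b : 𝔸) - (V b : 𝔸)‖ ≤ δ * η)

/-! ## §1 The two new letters: the η-free two-background derivative defect and the Gram floor off the flat reference -/

omit [NeZero L] [∀ i, NeZero (m i)] [CompleteSpace 𝔸] [Fact (0 < c₁)] [FiniteDimensional ℂ W] in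
include hMφ hMφ' hφ hφ' hηL hδ hUb hVb hUV in
/-- **THE TWO-BACKGROUND DERIVATIVE DEFECT IS η-FREE IN PRINT's SCALED WINDOW**: `‖D_Uλ − D_Vλ‖ ≤ √d·2M_φM_φ′·δ·‖λ‖` for `‖U(b) − V(b)‖ ≤ δη` — the
transporters are `2M_φM_φ′·δη`-close (`norm_adTransportW_sub_adTransportW_le`), the derivative carries `‖η⁻¹‖` (`norm_covDerivL2K_sub_le₂`), `‖η⁻¹‖·η = 1`.
[cite: Balaban1985BackgroundPropagators, (3.35) p.396, (3.70)–(3.71) pp.404–405] -/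
theorem norm_covDerivL2K_sub_le_diagonal₂ (lam : SiteL2K ℂ d (towerP L m (n + 1)) c₀ W) :
    ‖covDerivL2K ℂ c₀ ((η : ℂ))⁻¹ (adTransportW φ U) lam - covDerivL2K ℂ c₀ ((η : ℂ))⁻¹ (adTransportW φ V) lam‖ ≤
      (Real.sqrt d * (2 * Mφ * Mφ') * δ) * ‖lam‖ := by
  have hη0 : 0 < η := eta_pos_of_diagonal L n η hηL
  have hδR : 0 ≤ 2 * Mφ * Mφ' * (δ * η) := by positivity
  have hRR' : ∀ (b : Bond d (towerP L m (n + 1))) (w : W), ‖adTransportW φ U b w - adTransportW φ V b w‖ ≤ 2 * Mφ * Mφ' * (δ * η) * ‖w‖ :=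
    fun b w => norm_adTransportW_sub_adTransportW_le L (towerP L m n) φ hφ hφ' hMφ' U V b (hUb b) (hVb b) (hUV b) w
  have h := norm_covDerivL2K_sub_le₂ (((η : ℂ))⁻¹) hδR hRR' lam
  have hηinv : ‖((η : ℂ))⁻¹‖ * η = 1 := by
    rw [norm_inv, Complex.norm_real, Real.norm_eq_abs, abs_of_pos hη0, inv_mul_cancel₀ hη0.ne']
  calc _ ≤ ‖((η : ℂ))⁻¹‖ * (2 * Mφ * Mφ' * (δ * η)) * Real.sqrt d * ‖lam‖ := h
    _ = (Real.sqrt d * (2 * Mφ * Mφ') * δ) * (‖((η : ℂ))⁻¹‖ * η) * ‖lam‖ := by ring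
    _ = (Real.sqrt d * (2 * Mφ * Mφ') * δ) * ‖lam‖ := by rw [hηinv, mul_one]

omit [NormOneClass 𝔸] in
include hRSV in
/-- **THE GRAM FLOOR OFF THE FLAT REFERENCE**: with `A_V = G′_k(V)Q̃′_k(V)†`, `A_1 = G′_k(1)Q̃′_k(1)†` (`re⟨ψ, K′_k(·)ψ⟩ = ‖A_·ψ‖²`, `inner_qggq_eq`), a flat floor
`s²‖ψ‖² ≤ re⟨ψ, K′_k(1)ψ⟩` and the letters `θ_G, M_V, θ_Q, g₁` between `V` and `1` (adjoints by leaf-01's `norm_adjoint_apply_le`) with `θ_GM_V + g₁θ_Q ≤ s`: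
**`(s − (θ_GM_V + g₁θ_Q))²·‖ψ‖² ≤ re⟨ψ, K′_k(V)ψ⟩`** — the `κ₀` letter of `norm_RofUk_sub_RofUk_le_sqrt` at a NON-flat reference. [cite: Balaban1985BackgroundPropagators, (3.25) p.394, (3.63)–(3.68) pp.402–403, Thm 3.11 p.416] -/
theorem qggqk_coercive_of_near_flat (hη : η ≠ 0)
    (hposV : ∀ x : SiteL2K ℂ d (towerP L m (n + 1)) c₀ W, x ≠ 0 → 0 < RCLike.re ⟪x, laplacePrimeAk L m n φ η V a' (c₁ := c₁) x⟫_ℂ)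
    {s θG MV θQ g₁ : ℝ} (hs : 0 ≤ s) (hθG : 0 ≤ θG) (hMV : 0 ≤ MV) (hθQ : 0 ≤ θQ) (hg₁ : 0 ≤ g₁)
    (hflat : ∀ ψ : SiteL2K ℂ d m c₁ W, s ^ 2 * ‖ψ‖ ^ 2 ≤ RCLike.re ⟪ψ,
      (((WL2.linearEquiv ℂ ℂ (fun _ : TSite d m => c₁)).symm.toLinearMap ∘ₗ
          QprimeTowerW L m n φ (fun _ : Bond d (towerP L m (n + 1)) => (1 : 𝔸ˣ)) (c₀ := c₀)) ∘ₗ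
        GpOfUk L m n φ η (fun _ : Bond d (towerP L m (n + 1)) => (1 : 𝔸ˣ)) a' (c₁ := c₁) (laplacePrimeAk_one_pos L m n φ η a' hη ha') ∘ₗ
        GpOfUk L m n φ η (fun _ : Bond d (towerP L m (n + 1)) => (1 : 𝔸ˣ)) a' (c₁ := c₁) (laplacePrimeAk_one_pos L m n φ η a' hη ha') ∘ₗ
        LinearMap.adjoint ((WL2.linearEquiv ℂ ℂ (fun _ : TSite d m => c₁)).symm.toLinearMap ∘ₗ
          QprimeTowerW L m n φ (fun _ : Bond d (towerP L m (n + 1)) => (1 : 𝔸ˣ)) (c₀ := c₀))) ψ⟫_ℂ)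
    (hG : ∀ y : SiteL2K ℂ d (towerP L m (n + 1)) c₀ W, ‖GpOfUk L m n φ η V a' (c₁ := c₁) hposV y -
      GpOfUk L m n φ η (fun _ : Bond d (towerP L m (n + 1)) => (1 : 𝔸ˣ)) a' (c₁ := c₁) (laplacePrimeAk_one_pos L m n φ η a' hη ha') y‖ ≤ θG * ‖y‖)
    (hQV : ∀ v, ‖((WL2.linearEquiv ℂ ℂ (fun _ : TSite d m => c₁)).symm.toLinearMap ∘ₗ QprimeTowerW L m n φ V (c₀ := c₀)) v‖ ≤ MV * ‖v‖)
    (hdQ : ∀ v, ‖((WL2.linearEquiv ℂ ℂ (fun _ : TSite d m => c₁)).symm.toLinearMap ∘ₗ QprimeTowerW L m n φ V (c₀ := c₀)) v -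
      ((WL2.linearEquiv ℂ ℂ (fun _ : TSite d m => c₁)).symm.toLinearMap ∘ₗ
        QprimeTowerW L m n φ (fun _ : Bond d (towerP L m (n + 1)) => (1 : 𝔸ˣ)) (c₀ := c₀)) v‖ ≤ θQ * ‖v‖)
    (hG₁ : ∀ y : SiteL2K ℂ d (towerP L m (n + 1)) c₀ W,
      ‖GpOfUk L m n φ η (fun _ : Bond d (towerP L m (n + 1)) => (1 : 𝔸ˣ)) a' (c₁ := c₁) (laplacePrimeAk_one_pos L m n φ η a' hη ha') y‖ ≤ g₁ * ‖y‖)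
    (hwin : θG * MV + g₁ * θQ ≤ s) (ψ : SiteL2K ℂ d m c₁ W) :
    (s - (θG * MV + g₁ * θQ)) ^ 2 * ‖ψ‖ ^ 2 ≤ RCLike.re ⟪ψ,
      (((WL2.linearEquiv ℂ ℂ (fun _ : TSite d m => c₁)).symm.toLinearMap ∘ₗ QprimeTowerW L m n φ V (c₀ := c₀)) ∘ₗ
        GpOfUk L m n φ η V a' (c₁ := c₁) hposV ∘ₗ GpOfUk L m n φ η V a' (c₁ := c₁) hposV ∘ₗ
        LinearMap.adjoint ((WL2.linearEquiv ℂ ℂ (fun _ : TSite d m => c₁)).symm.toLinearMap ∘ₗ QprimeTowerW L m n φ V (c₀ := c₀))) ψ⟫_ℂ := by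
  set qV := (WL2.linearEquiv ℂ ℂ (fun _ : TSite d m => c₁)).symm.toLinearMap ∘ₗ QprimeTowerW L m n φ V (c₀ := c₀) with hqV
  set q1 := (WL2.linearEquiv ℂ ℂ (fun _ : TSite d m => c₁)).symm.toLinearMap ∘ₗ
    QprimeTowerW L m n φ (fun _ : Bond d (towerP L m (n + 1)) => (1 : 𝔸ˣ)) (c₀ := c₀) with hq1
  set GV := GpOfUk L m n φ η V a' (c₀ := c₀) (c₁ := c₁) hposV with hGV
  set G1 := GpOfUk L m n φ η (fun _ : Bond d (towerP L m (n + 1)) => (1 : 𝔸ˣ)) a' (c₀ := c₀) (c₁ := c₁) (laplacePrimeAk_one_pos L m n φ η a' hη ha')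
    with hG1
  -- both Gram forms are squares of norms
  have eV : RCLike.re ⟪ψ, (qV ∘ₗ GV ∘ₗ GV ∘ₗ LinearMap.adjoint qV) ψ⟫_ℂ = ‖GV (LinearMap.adjoint qV ψ)‖ ^ 2 := by
    have e := inner_qggq_eq qV (laplacePrimeAk_isSymmetric L m n φ η V a' hRSV) hposV ψ
    simp only [LinearMap.comp_apply]
    rw [hGV]; unfold GpOfUk
    rw [e, ← RCLike.ofReal_pow, RCLike.ofReal_re]
  have e1 : RCLike.re ⟪ψ, (q1 ∘ₗ G1 ∘ₗ G1 ∘ₗ LinearMap.adjoint q1) ψ⟫_ℂ = ‖G1 (LinearMap.adjoint q1 ψ)‖ ^ 2 := by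
    have e := inner_qggq_eq q1
      (laplacePrimeAk_isSymmetric L m n φ η (fun _ : Bond d (towerP L m (n + 1)) => (1 : 𝔸ˣ)) a' (c₀ := c₀) (c₁ := c₁) (hRS_one φ))
      (laplacePrimeAk_one_pos L m n φ η a' hη ha') ψ
    simp only [LinearMap.comp_apply]
    rw [hG1]; unfold GpOfUk
    rw [e, ← RCLike.ofReal_pow, RCLike.ofReal_re]
  -- the flat floor in norm form: `s‖ψ‖ ≤ ‖A_1ψ‖`
  have hfl : s * ‖ψ‖ ≤ ‖G1 (LinearMap.adjoint q1 ψ)‖ := by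
    have h := hflat ψ
    rw [e1, ← mul_pow] at h
    exact (pow_le_pow_iff_left₀ (by positivity : 0 ≤ s * ‖ψ‖) (norm_nonneg _) two_ne_zero).1 h
  -- the adjoint letters and `‖A_Vψ − A_1ψ‖ ≤ δ⁽¹⁾‖ψ‖`
  have hadjV : ‖LinearMap.adjoint qV ψ‖ ≤ MV * ‖ψ‖ := norm_adjoint_apply_le qV hMV hQV ψ
  have hadjd : ‖LinearMap.adjoint qV ψ - LinearMap.adjoint q1 ψ‖ ≤ θQ * ‖ψ‖ := by
    have h := norm_adjoint_apply_le (qV - q1) hθQ (fun v => by rw [LinearMap.sub_apply]; exact hdQ v) ψ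
    rwa [map_sub, LinearMap.sub_apply] at h
  have hdiff : ‖GV (LinearMap.adjoint qV ψ) - G1 (LinearMap.adjoint q1 ψ)‖ ≤ (θG * MV + g₁ * θQ) * ‖ψ‖ := by
    have e : GV (LinearMap.adjoint qV ψ) - G1 (LinearMap.adjoint q1 ψ) =
        (GV (LinearMap.adjoint qV ψ) - G1 (LinearMap.adjoint qV ψ)) + G1 (LinearMap.adjoint qV ψ - LinearMap.adjoint q1 ψ) := by
      rw [map_sub]; abel
    rw [e]
    refine (norm_add_le _ _).trans ?_
    have h1 : ‖GV (LinearMap.adjoint qV ψ) - G1 (LinearMap.adjoint qV ψ)‖ ≤ θG * (MV * ‖ψ‖) :=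
      (hG _).trans (mul_le_mul_of_nonneg_left hadjV hθG)
    have h2 : ‖G1 (LinearMap.adjoint qV ψ - LinearMap.adjoint q1 ψ)‖ ≤ g₁ * (θQ * ‖ψ‖) :=
      (hG₁ _).trans (mul_le_mul_of_nonneg_left hadjd hg₁)
    nlinarith [h1, h2]
  -- `‖A_Vψ‖ ≥ (s − δ⁽¹⁾)‖ψ‖ ≥ 0`
  have hlow : (s - (θG * MV + g₁ * θQ)) * ‖ψ‖ ≤ ‖GV (LinearMap.adjoint qV ψ)‖ := by
    have h' : ‖G1 (LinearMap.adjoint q1 ψ)‖ ≤ ‖GV (LinearMap.adjoint qV ψ)‖ + ‖GV (LinearMap.adjoint qV ψ) - G1 (LinearMap.adjoint q1 ψ)‖ := by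
      have := norm_le_norm_add_norm_sub' (G1 (LinearMap.adjoint q1 ψ)) (GV (LinearMap.adjoint qV ψ))
      rwa [norm_sub_rev] at this
    nlinarith [hfl, hdiff, h']
  rw [eV, ← mul_pow]
  exact pow_le_pow_left₀ (mul_nonneg (by linarith) (norm_nonneg _)) hlow 2

/-! ## §2 The two-background `k`-level `R`-letter on the diagonal, modulo the two displayed `Q̃′`-letters `θ₁`, `θ₂` -/

include hMφ hMφ' hφ hφ' ha' hηL hw hRSU hRSV hα hδ hUb hVb hUε hVε hUV in
/-- **THE TWO-BACKGROUND `k`-LEVEL `R`-LETTER ON PRINT's DIAGONAL MODULO `θ₁`, `θ₂`**: at `ηL^{n+1} = 1`, `c₀(L^{n+1})^d = c₁`, for `U`, `V` in the fine-bond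
window `αη` (`U1`-valued, `hRS`) with `‖U(b) − V(b)‖ ≤ δη`, and the displayed letters `‖Q̃′_k(U)v − Q̃′_k(1)v‖, ‖Q̃′_k(V)v − Q̃′_k(1)v‖ ≤ θ₁‖v‖`,
`‖Q̃′_k(U)v − Q̃′_k(V)v‖ ≤ θ₂‖v‖`, the derivative letters as upper bounds `√d·2M_φM_φ′α ≤ δ_D⁽¹⁾`, `√d·2M_φM_φ′δ ≤ δ_D⁽²⁾` (so a consumer may
freeze them at a window `α₀`); with the CLOSED letters of the module docstring (definitional equalities) in the windows `0 < γ`, `δ_D⁽¹⁾ ≤ 1∕(2+2∕a′)`,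
`δ_A⁽¹⁾ ≤ s♯`, `δ_A⁽²⁾ < s♯ − δ_A⁽¹⁾`: **`‖R_k(U)f − R_k(V)f‖ ≤ (δ_A⁽²⁾∕((s♯ − δ_A⁽¹⁾) − δ_A⁽²⁾) + δ_A⁽²⁾∕(s♯ − δ_A⁽¹⁾))·‖f‖`** —
`B9Eq325RLipschitzSqrtTower.norm_RofUk_sub_RofUk_le_sqrt` at the reference `V` with §1's floor `(s♯ − δ_A⁽¹⁾)²`, `B9Eq364GreenLipschitzFormTower` (`γ`, positivity,
`θ_G⁽¹⁾`, `θ_G⁽²⁾`) and the diagonal file's flat letters.  NO `η`, `L`, `m`, `n` in any constant. [cite: Balaban1985BackgroundPropagators, p.403, (3.25) p.394, (3.35) p.396, (3.63)–(3.68) pp.402–403, Thm 3.11 p.416] -/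
theorem norm_RofUk_sub_RofUk_le_diagonal_of_thetaQ {θ₁ θ₂ δD₁ δD₂ γ θG₁ δA₁ θG₂ δA₂ : ℝ} (hθ₁ : 0 ≤ θ₁) (hθ₂ : 0 ≤ θ₂)
    (hdQU : ∀ v : SiteL2K ℂ d (towerP L m (n + 1)) c₀ W,
      ‖((WL2.linearEquiv ℂ ℂ (fun _ : TSite d m => c₁)).symm.toLinearMap ∘ₗ QprimeTowerW L m n φ U (c₀ := c₀)) v -
        ((WL2.linearEquiv ℂ ℂ (fun _ : TSite d m => c₁)).symm.toLinearMap ∘ₗ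
          QprimeTowerW L m n φ (fun _ : Bond d (towerP L m (n + 1)) => (1 : 𝔸ˣ)) (c₀ := c₀)) v‖ ≤ θ₁ * ‖v‖)
    (hdQV : ∀ v : SiteL2K ℂ d (towerP L m (n + 1)) c₀ W,
      ‖((WL2.linearEquiv ℂ ℂ (fun _ : TSite d m => c₁)).symm.toLinearMap ∘ₗ QprimeTowerW L m n φ V (c₀ := c₀)) v -
        ((WL2.linearEquiv ℂ ℂ (fun _ : TSite d m => c₁)).symm.toLinearMap ∘ₗ
          QprimeTowerW L m n φ (fun _ : Bond d (towerP L m (n + 1)) => (1 : 𝔸ˣ)) (c₀ := c₀)) v‖ ≤ θ₁ * ‖v‖)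
    (hdQUV : ∀ v : SiteL2K ℂ d (towerP L m (n + 1)) c₀ W,
      ‖((WL2.linearEquiv ℂ ℂ (fun _ : TSite d m => c₁)).symm.toLinearMap ∘ₗ QprimeTowerW L m n φ U (c₀ := c₀)) v -
        ((WL2.linearEquiv ℂ ℂ (fun _ : TSite d m => c₁)).symm.toLinearMap ∘ₗ QprimeTowerW L m n φ V (c₀ := c₀)) v‖ ≤ θ₂ * ‖v‖)
    (hδD₁ : Real.sqrt d * (2 * Mφ * Mφ') * α ≤ δD₁) (hδD₂ : Real.sqrt d * (2 * Mφ * Mφ') * δ ≤ δD₂)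
    (hγdef : γ = 1 / (2 + 2 / a') - (δD₁ + δD₁ ^ 2 + a' * θ₁ * (2 * 1 + θ₁)))
    (hθG₁def : θG₁ = 2 * δD₁ * (γ⁻¹ * (Real.sqrt γ)⁻¹) + (|a'| * θ₁ * ((1 + θ₁) + 1)) * γ⁻¹ ^ 2)
    (hδA₁def : δA₁ = θG₁ * (1 + θ₁) + (2 + 2 / a') * θ₁)
    (hθG₂def : θG₂ = 2 * δD₂ * (γ⁻¹ * (Real.sqrt γ)⁻¹) + (|a'| * θ₂ * ((1 + θ₁) + (1 + θ₁))) * γ⁻¹ ^ 2)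
    (hδA₂def : δA₂ = θG₂ * (1 + θ₁) + γ⁻¹ * θ₂)
    (hγ : 0 < γ) (hDγ : δD₁ ≤ 1 / (2 + 2 / a'))
    (hwin₁ : δA₁ ≤ Real.sqrt (1 / (12 * (d : ℝ) * (6 / 5) ^ (d - 1) + a') ^ 2))
    (hwin₂ : δA₂ < Real.sqrt (1 / (12 * (d : ℝ) * (6 / 5) ^ (d - 1) + a') ^ 2) - δA₁)
    (f : SiteL2K ℂ d (towerP L m (n + 1)) c₀ W) :
    ‖RofUk L m n φ η U (c₀ := c₀) f - RofUk L m n φ η V (c₀ := c₀) f‖ ≤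
      (δA₂ / ((Real.sqrt (1 / (12 * (d : ℝ) * (6 / 5) ^ (d - 1) + a') ^ 2) - δA₁) - δA₂) +
        δA₂ / (Real.sqrt (1 / (12 * (d : ℝ) * (6 / 5) ^ (d - 1) + a') ^ 2) - δA₁)) * ‖f‖ := by
  have hη : η ≠ 0 := (eta_pos_of_diagonal L n η hηL).ne'
  have hδD₁0 : 0 ≤ δD₁ := le_trans (by positivity) hδD₁
  have hδD₂0 : 0 ≤ δD₂ := le_trans (by positivity) hδD₂
  set s : ℝ := Real.sqrt (1 / (12 * (d : ℝ) * (6 / 5) ^ (d - 1) + a') ^ 2) with hsdef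
  have hs0 : 0 ≤ s := Real.sqrt_nonneg _
  -- the derivative defects: each background against the flat one (`δ_D⁽¹⁾`), and against each other (`δ_D⁽²⁾`)
  have hDU : ∀ l : SiteL2K ℂ d (towerP L m (n + 1)) c₀ W, ‖covDerivL2K ℂ c₀ ((η : ℂ))⁻¹ (adTransportW φ U) l -
      covDerivL2K ℂ c₀ ((η : ℂ))⁻¹ (adTransportW φ (fun _ : Bond d (towerP L m (n + 1)) => (1 : 𝔸ˣ))) l‖ ≤ δD₁ * ‖l‖ := fun l =>
    (norm_covDerivL2K_sub_flat_le_diagonal L m n φ hMφ hMφ' hφ hφ' c₀ η hηL U hα hUb hUε l).trans (mul_le_mul_of_nonneg_right hδD₁ (norm_nonneg _))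
  have hDV : ∀ l : SiteL2K ℂ d (towerP L m (n + 1)) c₀ W, ‖covDerivL2K ℂ c₀ ((η : ℂ))⁻¹ (adTransportW φ V) l -
      covDerivL2K ℂ c₀ ((η : ℂ))⁻¹ (adTransportW φ (fun _ : Bond d (towerP L m (n + 1)) => (1 : 𝔸ˣ))) l‖ ≤ δD₁ * ‖l‖ := fun l =>
    (norm_covDerivL2K_sub_flat_le_diagonal L m n φ hMφ hMφ' hφ hφ' c₀ η hηL V hα hVb hVε l).trans (mul_le_mul_of_nonneg_right hδD₁ (norm_nonneg _))
  have hDV' : ∀ l : SiteL2K ℂ d (towerP L m (n + 1)) c₀ W,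
      ‖covDerivL2K ℂ c₀ ((η : ℂ))⁻¹ (adTransportW φ (fun _ : Bond d (towerP L m (n + 1)) => (1 : 𝔸ˣ))) l -
        covDerivL2K ℂ c₀ ((η : ℂ))⁻¹ (adTransportW φ V) l‖ ≤ δD₁ * ‖l‖ := fun l => by rw [norm_sub_rev]; exact hDV l
  have hDUV' : ∀ l : SiteL2K ℂ d (towerP L m (n + 1)) c₀ W,
      ‖covDerivL2K ℂ c₀ ((η : ℂ))⁻¹ (adTransportW φ V) l - covDerivL2K ℂ c₀ ((η : ℂ))⁻¹ (adTransportW φ U) l‖ ≤ δD₂ * ‖l‖ := fun l => by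
    rw [norm_sub_rev]
    exact (norm_covDerivL2K_sub_le_diagonal₂ L m n φ hMφ hMφ' hφ hφ' c₀ η hηL U V hδ hUb hVb hUV l).trans (mul_le_mul_of_nonneg_right hδD₂ (norm_nonneg _))
  -- the `Q̃′`-letters
  have hQ1 : ∀ v : SiteL2K ℂ d (towerP L m (n + 1)) c₀ W, ‖((WL2.linearEquiv ℂ ℂ (fun _ : TSite d m => c₁)).symm.toLinearMap ∘ₗ
      QprimeTowerW L m n φ (fun _ : Bond d (towerP L m (n + 1)) => (1 : 𝔸ˣ)) (c₀ := c₀)) v‖ ≤ 1 * ‖v‖ := fun v => by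
    rw [one_mul]; exact norm_QtildeTower_one_le_diagonal L m n φ c₀ c₁ hw v
  have hMQ : ∀ (X : Bond d (towerP L m (n + 1)) → 𝔸ˣ), (∀ v : SiteL2K ℂ d (towerP L m (n + 1)) c₀ W,
      ‖((WL2.linearEquiv ℂ ℂ (fun _ : TSite d m => c₁)).symm.toLinearMap ∘ₗ QprimeTowerW L m n φ X (c₀ := c₀)) v -
        ((WL2.linearEquiv ℂ ℂ (fun _ : TSite d m => c₁)).symm.toLinearMap ∘ₗ
          QprimeTowerW L m n φ (fun _ : Bond d (towerP L m (n + 1)) => (1 : 𝔸ˣ)) (c₀ := c₀)) v‖ ≤ θ₁ * ‖v‖) →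
      ∀ v : SiteL2K ℂ d (towerP L m (n + 1)) c₀ W,
        ‖((WL2.linearEquiv ℂ ℂ (fun _ : TSite d m => c₁)).symm.toLinearMap ∘ₗ QprimeTowerW L m n φ X (c₀ := c₀)) v‖ ≤ (1 + θ₁) * ‖v‖ := by
    intro X hX v
    have h1 := hQ1 v
    have h2 := hX v
    have h3 := norm_le_norm_add_norm_sub' (((WL2.linearEquiv ℂ ℂ (fun _ : TSite d m => c₁)).symm.toLinearMap ∘ₗ QprimeTowerW L m n φ X (c₀ := c₀)) v)
      (((WL2.linearEquiv ℂ ℂ (fun _ : TSite d m => c₁)).symm.toLinearMap ∘ₗ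
        QprimeTowerW L m n φ (fun _ : Bond d (towerP L m (n + 1)) => (1 : 𝔸ˣ)) (c₀ := c₀)) v)
    linarith
  have hQU := hMQ U hdQU
  have hQV := hMQ V hdQV
  have hdQV' := fun v => (norm_sub_rev _ _).trans_le (hdQV v)
  have hdQVU := fun v => (norm_sub_rev _ _).trans_le (hdQUV v)
  -- flat strong coercivity and the common coercivity `γ` of `Δ′_{a′,k}(U)`, `Δ′_{a′,k}(V)`, `Δ′_{a′,k}(1)`
  have hflat : ∀ l : SiteL2K ℂ d (towerP L m (n + 1)) c₀ W,
      (1 / (2 + 2 / a')) * (‖covDerivL2K ℂ c₀ ((η : ℂ))⁻¹ (adTransportW φ (fun _ : Bond d (towerP L m (n + 1)) => (1 : 𝔸ˣ))) l‖ ^ 2 + ‖l‖ ^ 2) ≤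
        RCLike.re ⟪l, laplacePrimeAk L m n φ η (fun _ : Bond d (towerP L m (n + 1)) => (1 : 𝔸ˣ)) a' (c₁ := c₁) l⟫_ℂ :=
    fun l => B9Thm311FlatLettersTower.flat_site_strong_coercive_tower_diagonal L m n φ c₀ η c₁ ha' hηL hw l
  have hcoU : ∀ l : SiteL2K ℂ d (towerP L m (n + 1)) c₀ W, γ * ‖l‖ ^ 2 ≤ RCLike.re ⟪l, laplacePrimeAk L m n φ η U a' (c₁ := c₁) l⟫_ℂ := fun l => by
    rw [hγdef]; exact coercive_laplacePrimeAk_of_letters L m n φ c₀ η U c₁ a' hRSU ha'.le hδD₁0 hθ₁ hDU hdQU hQ1 hDγ hflat l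
  have hcoV : ∀ l : SiteL2K ℂ d (towerP L m (n + 1)) c₀ W, γ * ‖l‖ ^ 2 ≤ RCLike.re ⟪l, laplacePrimeAk L m n φ η V a' (c₁ := c₁) l⟫_ℂ := fun l => by
    rw [hγdef]; exact coercive_laplacePrimeAk_of_letters L m n φ c₀ η V c₁ a' hRSV ha'.le hδD₁0 hθ₁ hDV hdQV hQ1 hDγ hflat l
  have hposU : ∀ x : SiteL2K ℂ d (towerP L m (n + 1)) c₀ W, x ≠ 0 → 0 < RCLike.re ⟪x, laplacePrimeAk L m n φ η U a' (c₁ := c₁) x⟫_ℂ :=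
    fun x hx => by nlinarith [hcoU x, (by positivity : 0 < ‖x‖ ^ 2)]
  have hposV : ∀ x : SiteL2K ℂ d (towerP L m (n + 1)) c₀ W, x ≠ 0 → 0 < RCLike.re ⟪x, laplacePrimeAk L m n φ η V a' (c₁ := c₁) x⟫_ℂ :=
    fun x hx => by nlinarith [hcoV x, (by positivity : 0 < ‖x‖ ^ 2)]
  have hco1 : ∀ l : SiteL2K ℂ d (towerP L m (n + 1)) c₀ W, γ * ‖l‖ ^ 2 ≤
      RCLike.re ⟪l, laplacePrimeAk L m n φ η (fun _ : Bond d (towerP L m (n + 1)) => (1 : 𝔸ˣ)) a' (c₁ := c₁) l⟫_ℂ := by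
    intro l
    have hle : γ ≤ 1 / (2 + 2 / a') := by
      rw [hγdef]; have : 0 ≤ δD₁ + δD₁ ^ 2 + a' * θ₁ * (2 * 1 + θ₁) := by positivity
      linarith
    exact (mul_le_mul_of_nonneg_right hle (sq_nonneg _)).trans (coercive_laplacePrimeAk_one_diagonal L m n φ c₀ η c₁ ha' hηL hw l)
  -- the `θ_G⁽¹⁾` letter (`V` against `1`) and the `θ_G⁽²⁾` letter (`U` against `V`)
  have hGV1 : ∀ y : SiteL2K ℂ d (towerP L m (n + 1)) c₀ W, ‖GpOfUk L m n φ η V a' (c₁ := c₁) hposV y -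
      GpOfUk L m n φ η (fun _ : Bond d (towerP L m (n + 1)) => (1 : 𝔸ˣ)) a' (c₁ := c₁) (laplacePrimeAk_one_pos L m n φ η a' hη ha') y‖ ≤ θG₁ * ‖y‖ := by
    intro y; rw [hθG₁def]
    exact norm_GpOfUk_sub_GpOfUk_le L m n φ c₀ η V (fun _ : Bond d (towerP L m (n + 1)) => (1 : 𝔸ˣ)) c₁ a' hRSV (hRS_one φ) hposV
      (laplacePrimeAk_one_pos L m n φ η a' hη ha') ha'.le hγ hδD₁0 (by positivity : (0:ℝ) ≤ 1 + θ₁) zero_le_one hθ₁ hcoV hco1 hDV' hQV hQ1 hdQV' y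
  have hGUV : ∀ y : SiteL2K ℂ d (towerP L m (n + 1)) c₀ W, ‖GpOfUk L m n φ η U a' (c₁ := c₁) hposU y -
      GpOfUk L m n φ η V a' (c₁ := c₁) hposV y‖ ≤ θG₂ * ‖y‖ := by
    intro y; rw [hθG₂def]
    exact norm_GpOfUk_sub_GpOfUk_le L m n φ c₀ η U V c₁ a' hRSU hRSV hposU hposV ha'.le hγ hδD₂0 (by positivity : (0:ℝ) ≤ 1 + θ₁)
      (by positivity : (0:ℝ) ≤ 1 + θ₁) hθ₂ hcoU hcoV hDUV' hQU hQV hdQVU y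
  -- the Green bounds: `g₁ = 2 + 2∕a′` (flat), `g_V = γ⁻¹`
  have hG1 : ∀ y : SiteL2K ℂ d (towerP L m (n + 1)) c₀ W,
      ‖GpOfUk L m n φ η (fun _ : Bond d (towerP L m (n + 1)) => (1 : 𝔸ˣ)) a' (c₁ := c₁) (laplacePrimeAk_one_pos L m n φ η a' hη ha') y‖ ≤
      (2 + 2 / a') * ‖y‖ := fun y => norm_GpOfUk_one_le_diagonal L m n φ c₀ η c₁ ha' hηL hw hη y
  have hGVb : ∀ y : SiteL2K ℂ d (towerP L m (n + 1)) c₀ W, ‖GpOfUk L m n φ η V a' (c₁ := c₁) hposV y‖ ≤ γ⁻¹ * ‖y‖ := by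
    intro y; unfold GpOfUk; exact norm_greenK_le hγ hcoV _ y
  -- the Gram floor at `V`, transported off the flat reference
  have hθG₁0 : 0 ≤ θG₁ := by rw [hθG₁def]; positivity
  have hθG₂0 : 0 ≤ θG₂ := by rw [hθG₂def]; positivity
  have hwin₁' : θG₁ * (1 + θ₁) + (2 + 2 / a') * θ₁ ≤ s := by rw [← hδA₁def]; exact hwin₁
  have hκV : ∀ ψ : SiteL2K ℂ d m c₁ W, (s - δA₁) ^ 2 * ‖ψ‖ ^ 2 ≤ RCLike.re ⟪ψ,
      (((WL2.linearEquiv ℂ ℂ (fun _ : TSite d m => c₁)).symm.toLinearMap ∘ₗ QprimeTowerW L m n φ V (c₀ := c₀)) ∘ₗ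
        GpOfUk L m n φ η V a' (c₁ := c₁) hposV ∘ₗ GpOfUk L m n φ η V a' (c₁ := c₁) hposV ∘ₗ
        LinearMap.adjoint ((WL2.linearEquiv ℂ ℂ (fun _ : TSite d m => c₁)).symm.toLinearMap ∘ₗ QprimeTowerW L m n φ V (c₀ := c₀))) ψ⟫_ℂ := by
    intro ψ
    have h := qggqk_coercive_of_near_flat L m n φ c₀ η c₁ ha' V hRSV hη hposV hs0 hθG₁0 (by positivity : (0:ℝ) ≤ 1 + θ₁) hθ₁
      (by positivity : (0:ℝ) ≤ 2 + 2 / a') (fun ψ' => by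
        have h' := qggqk_coercive_sharp_one_diagonal L m n φ c₀ η c₁ ha' hηL hw hη ψ'
        rwa [hsdef, Real.sq_sqrt (by positivity)]) hGV1 hQV hdQV hG1 hwin₁' ψ
    rwa [← hδA₁def] at h
  -- assemble on the `κ^{−1∕2}` road at the reference `V`
  have hsV : 0 < s - δA₁ := by linarith [(show 0 ≤ δA₂ by rw [hδA₂def]; positivity), hwin₂]
  have hκ0 : 0 < (s - δA₁) ^ 2 := by positivity
  have hwin' : θG₂ * (1 + θ₁) + γ⁻¹ * θ₂ < Real.sqrt ((s - δA₁) ^ 2) := by rw [Real.sqrt_sq hsV.le, ← hδA₂def]; exact hwin₂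
  have h := norm_RofUk_sub_RofUk_le_sqrt L m n φ c₀ η U V c₁ a' hRSU hRSV hposU hposV hκ0 hθG₂0 (by positivity : (0:ℝ) ≤ 1 + θ₁) hθ₂
    (by positivity : (0:ℝ) ≤ γ⁻¹) hκV hGUV hQU hdQUV hGVb hwin' f
  rwa [Real.sqrt_sq hsV.le, ← hδA₂def] at h

/-! ## §3 `θ₁`, `θ₂` discharged by the tower products: the two-background `k`-level `R`-letter with every letter a closed form -/

include hMφ hMφ' hφ hφ' ha' hηL hw hRSU hRSV hα hδ hUb hVb hUε hVε hUV in
/-- **THE TWO-BACKGROUND `k`-LEVEL `R`-LETTER ON PRINT's DIAGONAL, EVERY LETTER CLOSED** — as §2 with `θ₁ := Π_{j≤n}(1+2M_φM_φ′ε_j)^{d(L−1)} − 1` and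
`θ₂ := (θ₁ + 1)·(Π_{j≤n}(1 + d(L−1)·2M_φM_φ′δ_j·(1+2M_φM_φ′ε_j)^{d(L−1)}) − 1)` for level averages `Ū^j(b), V̄^j(b) ∈ U1` with `‖Ū^j(b) − 1‖, ‖V̄^j(b) − 1‖ ≤ ε_j`
and `‖Ū^j(b) − V̄^j(b)‖ ≤ δ_j` (DISPLAYED): ne9-leaf-02's `norm_QtildeTower_sub_flat_le` and INTENT-1's `norm_QtildeTower_sub_QtildeTower_le` with
`√(c₁∕(c₀L^{(n+1)d})) = 1`.  The constants depend on `(d, a′, M_φM_φ′, α, δ)` and the displayed profile products only (level-free and `δ⋆`-linear under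
geometric profiles: INTENT-1's `profile_product_le_linear`); NO `η`, NO volume. [cite: Balaban1985BackgroundPropagators, p.403, (3.25) p.394, (3.35)–(3.37) p.396, (3.63)–(3.68) pp.402–403, Thm 3.11 p.416] -/
theorem norm_RofUk_sub_RofUk_le_diagonal (εU δUV : ℕ → ℝ) (hεU : ∀ j, 0 ≤ εU j) (hδUV : ∀ j, 0 ≤ δUV j)
    (hLεU : ∀ (j : ℕ) (b : Bond d (towerP L m (j + 1))), ‖(UlevOf L m (n + 1) U j b : 𝔸) - 1‖ ≤ εU j)
    (hLεV : ∀ (j : ℕ) (b : Bond d (towerP L m (j + 1))), ‖(UlevOf L m (n + 1) V j b : 𝔸) - 1‖ ≤ εU j)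
    (hLbU : ∀ (j : ℕ) (b : Bond d (towerP L m (j + 1))), UlevOf L m (n + 1) U j b ∈ U1 𝔸)
    (hLbV : ∀ (j : ℕ) (b : Bond d (towerP L m (j + 1))), UlevOf L m (n + 1) V j b ∈ U1 𝔸)
    (hLUV : ∀ (j : ℕ) (b : Bond d (towerP L m (j + 1))), ‖(UlevOf L m (n + 1) U j b : 𝔸) - (UlevOf L m (n + 1) V j b : 𝔸)‖ ≤ δUV j)
    {θ₁ θ₂ δD₁ δD₂ γ θG₁ δA₁ θG₂ δA₂ : ℝ}
    (hθ₁def : θ₁ = (∏ j ∈ Finset.range (n + 1), (1 + 2 * Mφ * Mφ' * εU j) ^ (d * (L - 1))) - 1)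
    (hθ₂def : θ₂ = (∏ j ∈ Finset.range (n + 1), (1 + 2 * Mφ * Mφ' * εU j) ^ (d * (L - 1))) *
      ((∏ j ∈ Finset.range (n + 1), (1 + (d * (L - 1) : ℕ) * (2 * Mφ * Mφ' * δUV j) * (1 + 2 * Mφ * Mφ' * εU j) ^ (d * (L - 1)))) - 1))
    (hδD₁ : Real.sqrt d * (2 * Mφ * Mφ') * α ≤ δD₁) (hδD₂ : Real.sqrt d * (2 * Mφ * Mφ') * δ ≤ δD₂)
    (hγdef : γ = 1 / (2 + 2 / a') - (δD₁ + δD₁ ^ 2 + a' * θ₁ * (2 * 1 + θ₁)))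
    (hθG₁def : θG₁ = 2 * δD₁ * (γ⁻¹ * (Real.sqrt γ)⁻¹) + (|a'| * θ₁ * ((1 + θ₁) + 1)) * γ⁻¹ ^ 2)
    (hδA₁def : δA₁ = θG₁ * (1 + θ₁) + (2 + 2 / a') * θ₁)
    (hθG₂def : θG₂ = 2 * δD₂ * (γ⁻¹ * (Real.sqrt γ)⁻¹) + (|a'| * θ₂ * ((1 + θ₁) + (1 + θ₁))) * γ⁻¹ ^ 2)
    (hδA₂def : δA₂ = θG₂ * (1 + θ₁) + γ⁻¹ * θ₂)
    (hγ : 0 < γ) (hDγ : δD₁ ≤ 1 / (2 + 2 / a'))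
    (hwin₁ : δA₁ ≤ Real.sqrt (1 / (12 * (d : ℝ) * (6 / 5) ^ (d - 1) + a') ^ 2))
    (hwin₂ : δA₂ < Real.sqrt (1 / (12 * (d : ℝ) * (6 / 5) ^ (d - 1) + a') ^ 2) - δA₁)
    (f : SiteL2K ℂ d (towerP L m (n + 1)) c₀ W) :
    ‖RofUk L m n φ η U (c₀ := c₀) f - RofUk L m n φ η V (c₀ := c₀) f‖ ≤
      (δA₂ / ((Real.sqrt (1 / (12 * (d : ℝ) * (6 / 5) ^ (d - 1) + a') ^ 2) - δA₁) - δA₂) +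
        δA₂ / (Real.sqrt (1 / (12 * (d : ℝ) * (6 / 5) ^ (d - 1) + a') ^ 2) - δA₁)) * ‖f‖ := by
  have hε2 : ∀ j, 0 ≤ 2 * Mφ * Mφ' * εU j := fun j => by have := hεU j; positivity
  have hP1 : 1 ≤ ∏ j ∈ Finset.range (n + 1), (1 + 2 * Mφ * Mφ' * εU j) ^ (d * (L - 1)) :=
    Finset.one_le_prod (s := Finset.range (n + 1)) fun j _ => one_le_pow₀ (by linarith [hε2 j])
  have hT1 : 1 ≤ ∏ j ∈ Finset.range (n + 1), (1 + (d * (L - 1) : ℕ) * (2 * Mφ * Mφ' * δUV j) * (1 + 2 * Mφ * Mφ' * εU j) ^ (d * (L - 1))) :=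
    Finset.one_le_prod (s := Finset.range (n + 1)) fun j _ => by
      have := hδUV j; have := hε2 j
      have : 0 ≤ (d * (L - 1) : ℕ) * (2 * Mφ * Mφ' * δUV j) * (1 + 2 * Mφ * Mφ' * εU j) ^ (d * (L - 1)) := by positivity
      linarith
  have hθ₁0 : 0 ≤ θ₁ := by rw [hθ₁def]; linarith
  have hθ₂0 : 0 ≤ θ₂ := by rw [hθ₂def]; exact mul_nonneg (by linarith) (by linarith)
  have hone : Real.sqrt (c₁ / (c₀ * ((L : ℝ) ^ (n + 1)) ^ d)) = 1 := by rw [hw, div_self (Fact.out : 0 < c₁).ne', Real.sqrt_one]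
  have hdQ1 : ∀ (X : Bond d (towerP L m (n + 1)) → 𝔸ˣ), (∀ (j : ℕ) (b : Bond d (towerP L m (j + 1))), ‖(UlevOf L m (n + 1) X j b : 𝔸) - 1‖ ≤ εU j) →
      (∀ (j : ℕ) (b : Bond d (towerP L m (j + 1))), UlevOf L m (n + 1) X j b ∈ U1 𝔸) → ∀ v : SiteL2K ℂ d (towerP L m (n + 1)) c₀ W,
      ‖((WL2.linearEquiv ℂ ℂ (fun _ : TSite d m => c₁)).symm.toLinearMap ∘ₗ QprimeTowerW L m n φ X (c₀ := c₀)) v -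
        ((WL2.linearEquiv ℂ ℂ (fun _ : TSite d m => c₁)).symm.toLinearMap ∘ₗ
          QprimeTowerW L m n φ (fun _ : Bond d (towerP L m (n + 1)) => (1 : 𝔸ˣ)) (c₀ := c₀)) v‖ ≤ θ₁ * ‖v‖ := by
    intro X hXε hXb v
    have h := norm_QtildeTower_sub_flat_le L m n φ hMφ hMφ' hφ hφ' (c₀ := c₀) c₁ X εU hεU hXε hXb v
    rw [hone, mul_one] at h; rw [hθ₁def]; exact h
  have hdQUV : ∀ v : SiteL2K ℂ d (towerP L m (n + 1)) c₀ W,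
      ‖((WL2.linearEquiv ℂ ℂ (fun _ : TSite d m => c₁)).symm.toLinearMap ∘ₗ QprimeTowerW L m n φ U (c₀ := c₀)) v -
        ((WL2.linearEquiv ℂ ℂ (fun _ : TSite d m => c₁)).symm.toLinearMap ∘ₗ QprimeTowerW L m n φ V (c₀ := c₀)) v‖ ≤ θ₂ * ‖v‖ := by
    intro v
    have h := norm_QtildeTower_sub_QtildeTower_le L m n φ hMφ hMφ' hφ hφ' (c₀ := c₀) c₁ U V εU δUV hεU hδUV hLεU hLεV hLbU hLbV hLUV v
    rw [hone, mul_one] at h; rw [hθ₂def]; exact h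
  exact norm_RofUk_sub_RofUk_le_diagonal_of_thetaQ L m n φ hMφ hMφ' hφ hφ' c₀ η c₁ ha' hηL hw U V hRSU hRSV hα hδ hUb hVb hUε hVε hUV hθ₁0 hθ₂0
    (hdQ1 U hLεU hLbU) (hdQ1 V hLεV hLbV) hdQUV hδD₁ hδD₂ hγdef hθG₁def hδA₁def hθG₂def hδA₂def hγ hDγ hwin₁ hwin₂ f

end Literature.MathematicalPhysics.QuantumFieldTheory.Balaban1983to89.B9Eq325RLipschitzSqrtTowerTwoBackgroundsDiagonal

end
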